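import Mathlib
import Summits.KontsevichZagierPeriods.Zeta5Search.DoubleDropBonusProof
import HarnessLib

/-!
# ζ(5) search — the PALINDROMIC `V`-CARRIER BONUS is a THEOREM (`PalindromicVCarrierBonus`, gen-2 g9 REPORT §9.2)

Cell `pub-zeta5` (HONEST FRAMING: systematic search; no irrationality claim unless certified), typer seat
generation 9.  Discharges BY NAME `PalindromicVCarrierBonus` (`Zeta5Search/UniversalDigitCells.lean` §5): in regime `VB < m`
(`M = −m ≥ 3` the multipole minimum, `N = −VB > M` EVEN, attained only by single-pole classes) with every `V`-carrier (single-pole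
class with `ν_y = −N`) centre-free with palindromic exponent vector, the first Casoratian digit vanishes: `v_p(Cas_j(b)) ≥ casLB + 1`.

PROOF.  As for the double-drop bonus (`DoubleDropBonusProof.lean`): for `b' ∈ {b, b+e_j}`, `v(𝒦_p(b')) ≥ 3 − M` (single-pole
classes `≥ 1`, multipole classes `≥ 3 + E_x ≥ 3 − M`) and `v(V(b')) ≥ 1 − N` (`padicNorm_coeffV_le_dd`: `ν`-bounds and the conjugate
PAIRS of carriers, `padicNorm_classV_pair_le`; the carriers of `b + e_j` are the unhit carriers of `b`); `Ω`'s vanish for `p ≤ d`; and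
`casLB ≤ ν_{y*} + (3 + E_{x*}) = 3 − M − N`.  `p`-adic valuations of rationals; nothing about irrationality.
-/

noncomputable section

open Finset

namespace Summit.KontsevichZagierPeriods.Zeta5Search.ClusterValuation

open Summit.KontsevichZagierPeriods.Zeta5Search.DualSeries (InBox)
open Summit.KontsevichZagierPeriods.Zeta5Search.WedgeDictionary (coeffV dOf)
open Summit.KontsevichZagierPeriods.Zeta5Search.CasoratianValuation (InPolytope shift casoratian)
open Summit.KontsevichZagierPeriods.Zeta5Search.BigPrime (shift_zero)
open Summit.KontsevichZagierPeriods.Zeta5Search.PadicSeries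

variable {p : ℕ} [hp : Fact p.Prime]

/-- **`‖𝒦_p(b)‖ ≤ p^{−(3−M)}`** when every multipole class has `E_x ≥ −M` (`M ≥ 2`). -/
theorem padicNorm_kRes_le_vc (b : ℕ → ℤ) (hb : InPolytope b) (hp5 : 5 ≤ p) (hwin : (b 0 + 2 : ℤ) < (p : ℤ) ^ 2)
    {M : ℕ} (hM : 2 ≤ M) (hH : ∀ x, x < p → 2 ≤ classPoleCount b p x → -(M : ℤ) ≤ classExp b p x) :
    padicNorm p (kRes b p) ≤ (p : ℚ) ^ (-(3 - (M : ℤ))) := by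
  rw [kRes_eq_sum_classK b hp.out.pos]
  refine padicNorm.sum_le' (fun x hx => ?_) (zpow_p_nonneg _)
  have hx' := mem_range.1 hx
  rcases Nat.lt_trichotomy (classPoleCount b p x) 1 with h0 | h1 | h2
  · rw [classK_eq_zero_of_noPole b hb (by omega), padicNorm.zero]; exact zpow_p_nonneg _
  · exact (padicNorm_classK_le_single b hb hp5 hwin hx' h1).trans (zpow_le_zpow_right₀ one_le_p (by omega))
  · have := hH x hx' (by omega)
    exact (padicNorm_classK_le_multi b hb hp5 hwin hx' (by omega)).trans (zpow_le_zpow_right₀ one_le_p (by omega))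

omit hp in
/-- `casLB ≤ ν_{y*} + 3 + E_{x*}` for a pole class `y*` and a multipole class `x*`. -/
theorem casLB_le_of_witnesses (b : ℕ → ℤ) {x y : ℕ} (hx : x ∈ multipoleClasses b p) (hy : y < p)
    (hypole : 1 ≤ classPoleCount b p y) : casLB b p ≤ classNu b p y + (3 + classExp b p x) := by
  obtain ⟨hxr, hmulti⟩ := mem_filter.1 hx
  have hx' := mem_range.1 hxr
  obtain ⟨v, hv⟩ := vbMin_isSome b hy hypole
  obtain ⟨r, hr⟩ := rowMin_isSome b hx' (by omega)
  have h1 := vbMin_le b hv hy hypole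
  have h2 := rowMin_le_multi b hr hx' hmulti
  unfold casLB
  rw [hv, hr]
  simp only
  omega

/-! ### The bonus -/

/-- **`PalindromicVCarrierBonus` is a theorem.** -/
theorem palindromicVCarrierBonus_holds : PalindromicVCarrierBonus := by
  intro b p j N M hb hb' hj1 hj7 hprime hp5 hpb hpd hwin hM hMN hNe hmin hmul hcar0 hnu hcar hcas
  haveI : Fact p.Prime := ⟨hprime⟩
  have hp0 : 0 < p := hprime.pos
  have hp1 : (1 : ℚ) ≤ p := one_le_p
  have h0 : 0 ≤ b 0 := hb.1.1
  have hpn : p ≤ (b 0).toNat := by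
    have : (((b 0).toNat : ℕ) : ℤ) = b 0 := Int.toNat_of_nonneg h0
    omega
  have hwin' : (shift b j 0 + 2 : ℤ) < (p : ℤ) ^ 2 := by rwa [shift_zero b hj1]
  have hpn' : p ≤ (shift b j 0).toNat := by rwa [shift_zero b hj1]
  -- the multipole hypothesis for `b` and `b + e_j`
  have hmulx : ∀ x, x < p → 2 ≤ classPoleCount b p x → -(M : ℤ) ≤ classExp b p x :=
    fun x hx h2 => hmul x (mem_filter.2 ⟨mem_range.2 hx, h2⟩)
  have hmulx' : ∀ x, x < p → 2 ≤ classPoleCount (shift b j) p x → -(M : ℤ) ≤ classExp (shift b j) p x :=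
    fun x hx h2 => (hmulx x hx (h2.trans (classPoleCount_shift_le b hb.1 hj1 p x))).trans (classExp_shift_ge b hb.1 hj1 p x)
  -- the `V`-side hypotheses for `b`
  have hHb : ∀ x, x < p → 1 ≤ classPoleCount b p x → classExp b p x ≤ -(N : ℤ) →
      0 ≤ classNu b p x ∨ (classExp b p x = -(N : ℤ) ∧ ¬ CentreIn b p x ∧
        ∀ s ∈ classSet b p x, netExp b s = netExp b ((b 0).toNat - ((b 0).toNat - x) % p - (s - x))) := by
    intro x hx hpos hE
    by_cases h2 : 2 ≤ classPoleCount b p x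
    · have := hmul x (mem_filter.2 ⟨mem_range.2 hx, h2⟩); omega
    have h1 : classPoleCount b p x = 1 := by omega
    by_cases ht : tameSingle b p x = true
    · left; unfold classNu; rw [if_pos ⟨h1, ht⟩]; exact le_max_right _ _
    · have hnuE : classNu b p x = classExp b p x := by
        unfold classNu; rw [if_neg (fun h => ht h.2)]
      have hge := hnu x hx h1
      obtain ⟨hcx, hpal⟩ := hcar x hx h1 (by omega)
      exact Or.inr ⟨by omega, hcx, hpal⟩
  -- … and for `b + e_j` (the carriers of `b + e_j` are the unhit carriers of `b`)
  have hHb' : ∀ x, x < p → 1 ≤ classPoleCount (shift b j) p x → classExp (shift b j) p x ≤ -(N : ℤ) →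
      0 ≤ classNu (shift b j) p x ∨ (classExp (shift b j) p x = -(N : ℤ) ∧ ¬ CentreIn (shift b j) p x ∧
        ∀ s ∈ classSet (shift b j) p x, netExp (shift b j) s =
          netExp (shift b j) (((shift b j) 0).toNat - (((shift b j) 0).toNat - x) % p - (s - x))) := by
    intro x hx hpos hE'
    have hEge := classExp_shift_ge b hb.1 hj1 p x
    have hnuge := classNu_shift_ge b hb.1 hj1 hpos
    have hcnt := classPoleCount_shift_le b hb.1 hj1 p x
    by_cases h2 : 2 ≤ classPoleCount b p x
    · have := hmul x (mem_filter.2 ⟨mem_range.2 hx, h2⟩); omega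
    have h1 : classPoleCount b p x = 1 := by omega
    by_cases ht : tameSingle b p x = true
    · left
      have : 0 ≤ classNu b p x := by unfold classNu; rw [if_pos ⟨h1, ht⟩]; exact le_max_right _ _
      omega
    · have hnuE : classNu b p x = classExp b p x := by
        unfold classNu; rw [if_neg (fun h => ht h.2)]
      have hge := hnu x hx h1
      have hEeq : classExp (shift b j) p x = classExp b p x := by omega
      obtain ⟨hcx, hpal⟩ := hcar x hx h1 (by omega)
      right
      refine ⟨by omega, by rw [centreIn_shift b hj1]; exact hcx, ?_⟩
      have hnet := netExp_shift_eq_of_classExp_eq b hb.1 hj1 hEeq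
      intro s hs
      rw [classSet_shift b hj1] at hs
      rw [shift_zero b hj1, hnet s hs, hnet _ (palTau_class b hp0 hx hs).1]
      exact hpal s hs
  have hK := padicNorm_kRes_le_vc b hb hp5 hwin (by omega) hmulx
  have hK' := padicNorm_kRes_le_vc (shift b j) hb' hp5 hwin' (by omega) hmulx'
  have hV := padicNorm_coeffV_le_dd b hb hp5 hpn hwin (by omega) hNe hHb
  have hV' := padicNorm_coeffV_le_dd (shift b j) hb' hp5 hpn' hwin' (by omega) hNe hHb'
  -- the `Ω`-bracket vanishes for `p ≤ d`
  have hΩ : omegaRes b p = 0 := omegaRes_eq_zero b hb (by omega)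
  have hΩ' : omegaRes (shift b j) p = 0 :=
    omegaRes_eq_zero (shift b j) hb' (by rw [BigPrime.dOf_shift b hj1 hj7]; omega)
  -- the class bound
  obtain ⟨x, hx, hxE⟩ := hmin
  obtain ⟨y, hy, hy1, hyN⟩ := hcar0
  have hLB := casLB_le_of_witnesses b hx hy (by omega)
  rw [hyN, hxE] at hLB
  apply val_ge_of_padicNorm_le hcas
  rw [casoratian_split b j p, hΩ, hΩ', zero_mul, zero_mul, sub_zero, zero_sub, padicNorm.neg]
  refine ((padicNorm.sub (p := p)).trans (max_le (padicNorm_mul_le hK' hV) (padicNorm_mul_le hK hV'))).trans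
    (zpow_le_zpow_right₀ hp1 (by omega))

end Summit.KontsevichZagierPeriods.Zeta5Search.ClusterValuation

end
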